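import Summits.Ventures.LatticeQCDFlow.Exactness.IMHAnyStartPathSplit
import Summits.Ventures.LatticeQCDFlow.Exactness.IMHColdStartErrorBar
import HarnessLib

/-!
# Every start, second order: the mean-square error of a flow-MCMC time average from EVERY initial law —
# `MSE_{μ₀}(N; b) − MSE_π(N) = r^b·(MSE_ν(N) − MSE_π(N))`, so `(1 − r^b)·MSE_π ≤ MSE_{μ₀} ≤ (1 − r^b)·MSE_π + r^b·D²`

HONEST FRAMING: exact (Metropolis-corrected) sampling algorithms for lattice gauge theory;
figures of merit are autocorrelation/cost numbers at stated couplings and volumes; no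
continuum-physics claim.

Venture `LatticeQCDFlow` (cell pub-lqcd), topic `Exactness`; FANOUT row 30 (lean-1, GEN-35).  NEW WORK of the
cell, general state space.  GEN-34 split the flow-MCMC chain `K = indepMH q w` (proposal `q`, normalised weight
`w = dπ/dq`, `π = w·q`, `w` maximal at `x₀`, `A = 1/w(x₀)`, `r = 1 − A`) from EVERY initial law `μ₀` on path space:
`P_{μ₀}∘θ_b⁻¹ = (1 − r^b)·P_π + r^b·P_ν` (`Exactness/IMHAnyStartPathSplit`), and priced the FIRST order — the bias
of every statistic.  GEN-32 computed the SECOND order — the mean-square error of the time average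
`A_{N,b} = (1/N)·Σ_{i<N} f(X_{b+i})` — for the cold start only (`Exactness/IMHColdStart{MSE,WindowMSE,ErrorBar}`).
This file gives the second order from every start, with the exact constant:

* §1 bookkeeping: a time average of `a ≤ f ≤ c` lies in `[a, c]`; its squared deviation from `π f` is at most
  `D²`, `D = max(π f − a, c − π f)` (**`sq_timeAverage_sub_le`**).
* §2 **`imh_chain_windowMSE_anyStart_mem_Icc`** — FOR EVERY INITIAL LAW `μ₀`, every `b` and `N ≥ 1`:
  `MSE_{μ₀}(N; b) − MSE_π(N) ∈ [−r^b·MSE_π(N), r^b·(D² − MSE_π(N))]`, i.e. (**`…_ge`**)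
  `MSE_{μ₀}(N; b) ≥ (1 − r^b)·MSE_π(N)` — NO START, HOWEVER LUCKY, BEATS THE EQUILIBRIUM ERROR BY MORE THAN THE
  FACTOR `1 − r^b` — and (**`…_le`**) `MSE_{μ₀}(N; b) ≤ (1 − r^b)·MSE_π(N) + r^b·D²`; hence (**`…_abs_le`**)
  `|MSE_{μ₀}(N; b) − MSE_π(N)| ≤ r^b·D²` and the burn-in rule (**`…_abs_le_of_log_le`**): `log(1/ε) ≤ b/w(x₀)`
  discarded updates put the mean-square error of every start within `ε·D²` of the equilibrium one.
* §3 **`imh_chain_windowMSE_anyStart_exists`** — the exact form `MSE_{μ₀}(N; b) = (1 − r^b)·MSE_π(N) + r^b·MSE_ν(N)`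
  for SOME probability law `ν` (GEN-34's residual start), `MSE_ν(N)` the no-discard error of the run from `ν`.
* §4 **`imh_chain_windowMSE_anyStart_le_explicit`** — with the tree's equilibrium certificate
  `MSE_π(N) ≤ (2w(x₀) − 1)·Var_π f/N` (`IMHColdStartErrorBar.imh_chain_mse_stationary_le`):
  `MSE_{μ₀}(N; b) ≤ (2w(x₀) − 1)·Var_π f/N + r^b·D²` from every start (`…_of_log_le`: `+ ε·D²` once
  `log(1/ε) ≤ b/w(x₀)`) — THE ANY-START ERROR BAR WITH THE SAMPLER'S OWN CONSTANTS `w(x₀) = 1/A` AND `r`.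
* §5 **`imh_chain_windowDeviation_anyStart_le`** — THE EQUILIBRIUM CHEBYSHEV BAR HOLDS FROM EVERY START AT
  CONFIDENCE COST `r^b`: `P_{μ₀}(|A_{N,b} − π f| ≥ s) ≤ (1 − r^b)·MSE_π(N)/s² + r^b ≤ (2w(x₀) − 1)·Var_π f/(N s²) + r^b`
  (**`…_explicit`**) — a radius driven by `Var_π f`, not by the range (the range-driven Gaussian tail from every
  start is the Scoring row's `chain_abs_tail_le_exp_of_doeblin`, `IMHColdStartConfidence` §1).

Reading (for `Scaling/AutoregressiveGauge…AnyStartMSE`): an exact gauge sampler started anywhere, `b` configurations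
discarded, `N` kept, estimates every bounded observable with mean-square error within `(1 − A)^b·D²` of (and never
below `(1 − (1 − A)^b)×`) the equilibrium run's; `b·A ≥ log(1/ε)` makes the start invisible at second order up to `ε·D²`.
NOT CLAIMED: the sign of `MSE_{μ₀} − MSE_π` for a particular start (the cold start's is GEN-32's, exactly); the
`O(r^b/N²)` refinement of the start term (Scoring row's pair-sum bounds, halved rate; not typed here); unbounded `f`.
No `sorry`, no new definitions, nothing cited as a fact; general measurable space.
-/

noncomputable section

namespace Summit.Ventures.LatticeQCDFlow.Exactness

open MeasureTheory ProbabilityTheory Function Finset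
open scoped ENNReal
open Summit.Ventures.LatticeQCDFlow.Scoring

variable {Ω : Type*} [MeasurableSpace Ω] {q : Measure Ω} [IsProbabilityMeasure q] {w : Ω → ℝ}

/-! ## §1 Bookkeeping: the squared deviation of a time average is a bounded path statistic -/

omit [MeasurableSpace Ω] in
/-- A time average of `a ≤ f ≤ c` over `N ≥ 1` times lies in `[a, c]`. [ours, bookkeeping] -/
theorem timeAverage_mem_Icc {f : Ω → ℝ} {a c : ℝ} (ha : ∀ x, a ≤ f x) (hc : ∀ x, f x ≤ c) {N : ℕ} (hN : N ≠ 0)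
    (x : ℕ → Ω) (b : ℕ) : (∑ i ∈ range N, f (x (b + i))) / N ∈ Set.Icc a c := by
  have hNpos : (0 : ℝ) < N := by exact_mod_cast Nat.pos_of_ne_zero hN
  constructor
  · rw [le_div_iff₀ hNpos, ← nsmul_eq_mul', ← Finset.card_range N, ← Finset.sum_const, Finset.card_range]
    exact Finset.sum_le_sum fun i _ => ha _
  · rw [div_le_iff₀ hNpos, ← nsmul_eq_mul', ← Finset.card_range N, ← Finset.sum_const, Finset.card_range]
    exact Finset.sum_le_sum fun i _ => hc _

omit [MeasurableSpace Ω] in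
/-- **`(A_{N,b} − m)² ≤ D²`**, `D = max(m − a, c − m)`, for `a ≤ f ≤ c`, any `m`, `N ≥ 1`. [ours, bookkeeping] -/
theorem sq_timeAverage_sub_le {f : Ω → ℝ} {a c : ℝ} (ha : ∀ x, a ≤ f x) (hc : ∀ x, f x ≤ c) (m : ℝ)
    {N : ℕ} (hN : N ≠ 0) (x : ℕ → Ω) (b : ℕ) :
    ((∑ i ∈ range N, f (x (b + i))) / N - m) ^ 2 ≤ (max (m - a) (c - m)) ^ 2 := by
  obtain ⟨h1, h2⟩ := timeAverage_mem_Icc ha hc hN x b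
  have habs : |(∑ i ∈ range N, f (x (b + i))) / N - m| ≤ max (m - a) (c - m) := by
    rw [abs_le]
    constructor
    · exact le_trans (by rw [neg_le, neg_sub]; exact le_max_left _ _) (by linarith)
    · exact le_trans (by linarith) (le_max_right _ _)
  calc ((∑ i ∈ range N, f (x (b + i))) / N - m) ^ 2 = |(∑ i ∈ range N, f (x (b + i))) / N - m| ^ 2 := by
        rw [sq_abs]
    _ ≤ (max (m - a) (c - m)) ^ 2 := pow_le_pow_left₀ (abs_nonneg _) habs 2

/-- The squared deviation `x ↦ (A_N(x) − m)²` is a measurable path statistic. [ours, bookkeeping] -/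
theorem measurable_sq_timeAverage_sub {f : Ω → ℝ} (hf : Measurable f) (m : ℝ) (N : ℕ) :
    Measurable fun x : ℕ → Ω => ((∑ i ∈ range N, f (x i)) / N - m) ^ 2 :=
  (((Finset.measurable_sum _ fun i _ => hf.comp (measurable_pi_apply i)).div_const _).sub
    measurable_const).pow_const 2

/-! ## §2 The mean-square error from every start: the two-sided envelope -/

/-- **THE MEAN-SQUARE ERROR OF A TIME AVERAGE FROM EVERY START.**  `w` measurable (a `Fact`), positive,
normalised, maximal at `x₀`; `r = 1 − 1/w(x₀)`; `a ≤ f ≤ c` measurable, `D = max(π f − a, c − π f)`; `N ≥ 1`.  For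
every probability law `μ₀` and every `b`:
`E_{μ₀}[(A_{N,b} − π f)²] − E_π[(A_N − π f)²] ∈ [−r^b·MSE_π(N), r^b·(D² − MSE_π(N))]`. [ours] -/
theorem imh_chain_windowMSE_anyStart_mem_Icc [Fact (Measurable w)] (hw0 : ∀ y, 0 < w y) {x₀ : Ω}
    (hmax : ∀ y, w y ≤ w x₀) [IsProbabilityMeasure (q.withDensity fun y => ENNReal.ofReal (w y))]
    (μ₀ : Measure Ω) [IsProbabilityMeasure μ₀] {f : Ω → ℝ} (hf : Measurable f) {a c : ℝ}
    (ha : ∀ x, a ≤ f x) (hc : ∀ x, f x ≤ c) (b : ℕ) {N : ℕ} (hN : N ≠ 0) :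
    ∫ x, ((∑ i ∈ range N, f (x (b + i))) / N - ∫ z, f z ∂(q.withDensity fun y => ENNReal.ofReal (w y))) ^ 2
        ∂(Kernel.trajMeasure (X := fun _ : ℕ => Ω) μ₀
          (fun n : ℕ => (indepMH q w).comap (fun h : (i : ↥(Finset.Iic n)) → Ω => h ⟨n, Finset.mem_Iic.2 le_rfl⟩)
            (measurable_pi_apply _))) -
      ∫ x, ((∑ i ∈ range N, f (x i)) / N - ∫ z, f z ∂(q.withDensity fun y => ENNReal.ofReal (w y))) ^ 2
        ∂(Kernel.trajMeasure (X := fun _ : ℕ => Ω) (q.withDensity fun y => ENNReal.ofReal (w y))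
          (fun n : ℕ => (indepMH q w).comap (fun h : (i : ↥(Finset.Iic n)) → Ω => h ⟨n, Finset.mem_Iic.2 le_rfl⟩)
            (measurable_pi_apply _))) ∈
      Set.Icc
        (-((1 - (w x₀)⁻¹) ^ b *
          ∫ x, ((∑ i ∈ range N, f (x i)) / N - ∫ z, f z ∂(q.withDensity fun y => ENNReal.ofReal (w y))) ^ 2
            ∂(Kernel.trajMeasure (X := fun _ : ℕ => Ω) (q.withDensity fun y => ENNReal.ofReal (w y))
              (fun n : ℕ => (indepMH q w).comap (fun h : (i : ↥(Finset.Iic n)) → Ω => h ⟨n, Finset.mem_Iic.2 le_rfl⟩)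
                (measurable_pi_apply _)))))
        ((1 - (w x₀)⁻¹) ^ b *
          ((max (∫ z, f z ∂(q.withDensity fun y => ENNReal.ofReal (w y)) - a)
              (c - ∫ z, f z ∂(q.withDensity fun y => ENNReal.ofReal (w y)))) ^ 2 -
            ∫ x, ((∑ i ∈ range N, f (x i)) / N - ∫ z, f z ∂(q.withDensity fun y => ENNReal.ofReal (w y))) ^ 2
              ∂(Kernel.trajMeasure (X := fun _ : ℕ => Ω) (q.withDensity fun y => ENNReal.ofReal (w y))
                (fun n : ℕ => (indepMH q w).comap (fun h : (i : ↥(Finset.Iic n)) → Ω => h ⟨n, Finset.mem_Iic.2 le_rfl⟩)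
                  (measurable_pi_apply _))))) := by
  set m := ∫ z, f z ∂(q.withDensity fun y => ENNReal.ofReal (w y)) with hm
  have h := imh_chain_shift_integral_anyStart_mem_Icc (q := q) hw0 hmax μ₀
    (F := fun x : ℕ → Ω => ((∑ i ∈ range N, f (x i)) / N - m) ^ 2) (measurable_sq_timeAverage_sub hf m N)
    (a := 0) (c := (max (m - a) (c - m)) ^ 2) (fun x => sq_nonneg _)
    (fun x => by simpa using sq_timeAverage_sub_le ha hc m hN x 0) b
  simp only [zero_sub] at h
  simpa [neg_mul, mul_neg] using h

/-- **NO START BEATS `(1 − r^b)×` THE EQUILIBRIUM ERROR**: `E_{μ₀}[(A_{N,b} − π f)²] ≥ (1 − r^b)·MSE_π(N)`.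
[ours] -/
theorem imh_chain_windowMSE_anyStart_ge [Fact (Measurable w)] (hw0 : ∀ y, 0 < w y) {x₀ : Ω}
    (hmax : ∀ y, w y ≤ w x₀) [IsProbabilityMeasure (q.withDensity fun y => ENNReal.ofReal (w y))]
    (μ₀ : Measure Ω) [IsProbabilityMeasure μ₀] {f : Ω → ℝ} (hf : Measurable f) {a c : ℝ}
    (ha : ∀ x, a ≤ f x) (hc : ∀ x, f x ≤ c) (b : ℕ) {N : ℕ} (hN : N ≠ 0) :
    (1 - (1 - (w x₀)⁻¹) ^ b) *
        ∫ x, ((∑ i ∈ range N, f (x i)) / N - ∫ z, f z ∂(q.withDensity fun y => ENNReal.ofReal (w y))) ^ 2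
          ∂(Kernel.trajMeasure (X := fun _ : ℕ => Ω) (q.withDensity fun y => ENNReal.ofReal (w y))
            (fun n : ℕ => (indepMH q w).comap (fun h : (i : ↥(Finset.Iic n)) → Ω => h ⟨n, Finset.mem_Iic.2 le_rfl⟩)
              (measurable_pi_apply _))) ≤
      ∫ x, ((∑ i ∈ range N, f (x (b + i))) / N - ∫ z, f z ∂(q.withDensity fun y => ENNReal.ofReal (w y))) ^ 2
        ∂(Kernel.trajMeasure (X := fun _ : ℕ => Ω) μ₀
          (fun n : ℕ => (indepMH q w).comap (fun h : (i : ↥(Finset.Iic n)) → Ω => h ⟨n, Finset.mem_Iic.2 le_rfl⟩)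
            (measurable_pi_apply _))) := by
  obtain ⟨h1, -⟩ := imh_chain_windowMSE_anyStart_mem_Icc (q := q) hw0 hmax μ₀ hf ha hc b hN
  linarith

/-- **`E_{μ₀}[(A_{N,b} − π f)²] ≤ (1 − r^b)·MSE_π(N) + r^b·D²`** from every start. [ours] -/
theorem imh_chain_windowMSE_anyStart_le [Fact (Measurable w)] (hw0 : ∀ y, 0 < w y) {x₀ : Ω}
    (hmax : ∀ y, w y ≤ w x₀) [IsProbabilityMeasure (q.withDensity fun y => ENNReal.ofReal (w y))]
    (μ₀ : Measure Ω) [IsProbabilityMeasure μ₀] {f : Ω → ℝ} (hf : Measurable f) {a c : ℝ}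
    (ha : ∀ x, a ≤ f x) (hc : ∀ x, f x ≤ c) (b : ℕ) {N : ℕ} (hN : N ≠ 0) :
    ∫ x, ((∑ i ∈ range N, f (x (b + i))) / N - ∫ z, f z ∂(q.withDensity fun y => ENNReal.ofReal (w y))) ^ 2
        ∂(Kernel.trajMeasure (X := fun _ : ℕ => Ω) μ₀
          (fun n : ℕ => (indepMH q w).comap (fun h : (i : ↥(Finset.Iic n)) → Ω => h ⟨n, Finset.mem_Iic.2 le_rfl⟩)
            (measurable_pi_apply _))) ≤
      (1 - (1 - (w x₀)⁻¹) ^ b) *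
          ∫ x, ((∑ i ∈ range N, f (x i)) / N - ∫ z, f z ∂(q.withDensity fun y => ENNReal.ofReal (w y))) ^ 2
            ∂(Kernel.trajMeasure (X := fun _ : ℕ => Ω) (q.withDensity fun y => ENNReal.ofReal (w y))
              (fun n : ℕ => (indepMH q w).comap (fun h : (i : ↥(Finset.Iic n)) → Ω => h ⟨n, Finset.mem_Iic.2 le_rfl⟩)
                (measurable_pi_apply _))) +
        (1 - (w x₀)⁻¹) ^ b *
          (max (∫ z, f z ∂(q.withDensity fun y => ENNReal.ofReal (w y)) - a)
            (c - ∫ z, f z ∂(q.withDensity fun y => ENNReal.ofReal (w y)))) ^ 2 := by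
  obtain ⟨-, h2⟩ := imh_chain_windowMSE_anyStart_mem_Icc (q := q) hw0 hmax μ₀ hf ha hc b hN
  linarith

/-- **`|E_{μ₀}[(A_{N,b} − π f)²] − MSE_π(N)| ≤ r^b·D²`** from every start (the finer one-sided information
`∈ [−r^b·MSE_π(N), r^b·(D² − MSE_π(N))]` is `imh_chain_windowMSE_anyStart_mem_Icc`). [ours] -/
theorem imh_chain_windowMSE_anyStart_abs_le [Fact (Measurable w)] (hw0 : ∀ y, 0 < w y) {x₀ : Ω}
    (hmax : ∀ y, w y ≤ w x₀) [IsProbabilityMeasure (q.withDensity fun y => ENNReal.ofReal (w y))]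
    (μ₀ : Measure Ω) [IsProbabilityMeasure μ₀] {f : Ω → ℝ} (hf : Measurable f) {a c : ℝ}
    (ha : ∀ x, a ≤ f x) (hc : ∀ x, f x ≤ c) (b : ℕ) {N : ℕ} (hN : N ≠ 0) :
    |∫ x, ((∑ i ∈ range N, f (x (b + i))) / N - ∫ z, f z ∂(q.withDensity fun y => ENNReal.ofReal (w y))) ^ 2
        ∂(Kernel.trajMeasure (X := fun _ : ℕ => Ω) μ₀
          (fun n : ℕ => (indepMH q w).comap (fun h : (i : ↥(Finset.Iic n)) → Ω => h ⟨n, Finset.mem_Iic.2 le_rfl⟩)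
            (measurable_pi_apply _))) -
      ∫ x, ((∑ i ∈ range N, f (x i)) / N - ∫ z, f z ∂(q.withDensity fun y => ENNReal.ofReal (w y))) ^ 2
        ∂(Kernel.trajMeasure (X := fun _ : ℕ => Ω) (q.withDensity fun y => ENNReal.ofReal (w y))
          (fun n : ℕ => (indepMH q w).comap (fun h : (i : ↥(Finset.Iic n)) → Ω => h ⟨n, Finset.mem_Iic.2 le_rfl⟩)
            (measurable_pi_apply _)))| ≤
      (1 - (w x₀)⁻¹) ^ b *
        (max (∫ z, f z ∂(q.withDensity fun y => ENNReal.ofReal (w y)) - a)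
          (c - ∫ z, f z ∂(q.withDensity fun y => ENNReal.ofReal (w y)))) ^ 2 := by
  obtain ⟨h1, h2⟩ := imh_chain_windowMSE_anyStart_mem_Icc (q := q) hw0 hmax μ₀ hf ha hc b hN
  set m := ∫ z, f z ∂(q.withDensity fun y => ENNReal.ofReal (w y)) with hm
  set Pπ := Kernel.trajMeasure (X := fun _ : ℕ => Ω) (q.withDensity fun y => ENNReal.ofReal (w y))
    (fun n : ℕ => (indepMH q w).comap (fun h : (i : ↥(Finset.Iic n)) → Ω => h ⟨n, Finset.mem_Iic.2 le_rfl⟩)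
      (measurable_pi_apply _)) with hPπ
  have hW : 1 ≤ w x₀ := one_le_of_mode (q := q) hmax
  have hr0 : 0 ≤ (1 - (w x₀)⁻¹) ^ b := pow_nonneg (sub_nonneg.2 (inv_le_one_of_one_le₀ hW)) b
  have hMπ0 : 0 ≤ ∫ x, ((∑ i ∈ range N, f (x i)) / N - m) ^ 2 ∂Pπ := integral_nonneg fun x => sq_nonneg _
  have hMπD : ∫ x, ((∑ i ∈ range N, f (x i)) / N - m) ^ 2 ∂Pπ ≤ (max (m - a) (c - m)) ^ 2 := by
    have hbd : ∀ x : ℕ → Ω, ((∑ i ∈ range N, f (x i)) / N - m) ^ 2 ≤ (max (m - a) (c - m)) ^ 2 := fun x => by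
      simpa using sq_timeAverage_sub_le ha hc m hN x 0
    have := integral_mono (integrable_of_bounded Pπ (measurable_sq_timeAverage_sub hf m N)
      (C := (max (m - a) (c - m)) ^ 2) (fun x => by rw [abs_of_nonneg (sq_nonneg _)]; exact hbd x))
      (integrable_const ((max (m - a) (c - m)) ^ 2)) hbd
    rwa [integral_const, probReal_univ, one_smul] at this
  rw [abs_le]
  constructor <;> nlinarith

/-- **THE BURN-IN RULE AT SECOND ORDER**: `log(1/ε) ≤ b/w(x₀)` discarded updates leave
`|E_{μ₀}[(A_{N,b} − π f)²] − MSE_π(N)| ≤ ε·D²` from every start. [ours] -/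
theorem imh_chain_windowMSE_anyStart_abs_le_of_log_le [Fact (Measurable w)] (hw0 : ∀ y, 0 < w y) {x₀ : Ω}
    (hmax : ∀ y, w y ≤ w x₀) [IsProbabilityMeasure (q.withDensity fun y => ENNReal.ofReal (w y))]
    (μ₀ : Measure Ω) [IsProbabilityMeasure μ₀] {f : Ω → ℝ} (hf : Measurable f) {a c : ℝ}
    (ha : ∀ x, a ≤ f x) (hc : ∀ x, f x ≤ c) {b : ℕ} {N : ℕ} (hN : N ≠ 0) {ε : ℝ} (hε : 0 < ε)
    (hb : Real.log (1 / ε) ≤ b * (w x₀)⁻¹) :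
    |∫ x, ((∑ i ∈ range N, f (x (b + i))) / N - ∫ z, f z ∂(q.withDensity fun y => ENNReal.ofReal (w y))) ^ 2
        ∂(Kernel.trajMeasure (X := fun _ : ℕ => Ω) μ₀
          (fun n : ℕ => (indepMH q w).comap (fun h : (i : ↥(Finset.Iic n)) → Ω => h ⟨n, Finset.mem_Iic.2 le_rfl⟩)
            (measurable_pi_apply _))) -
      ∫ x, ((∑ i ∈ range N, f (x i)) / N - ∫ z, f z ∂(q.withDensity fun y => ENNReal.ofReal (w y))) ^ 2
        ∂(Kernel.trajMeasure (X := fun _ : ℕ => Ω) (q.withDensity fun y => ENNReal.ofReal (w y))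
          (fun n : ℕ => (indepMH q w).comap (fun h : (i : ↥(Finset.Iic n)) → Ω => h ⟨n, Finset.mem_Iic.2 le_rfl⟩)
            (measurable_pi_apply _)))| ≤
      ε * (max (∫ z, f z ∂(q.withDensity fun y => ENNReal.ofReal (w y)) - a)
          (c - ∫ z, f z ∂(q.withDensity fun y => ENNReal.ofReal (w y)))) ^ 2 := by
  exact (imh_chain_windowMSE_anyStart_abs_le (q := q) hw0 hmax μ₀ hf ha hc b hN).trans
    (mul_le_mul_of_nonneg_right (pow_mode_le_of_log_le (q := q) hmax hε hb) (sq_nonneg _))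

/-! ## §3 The exact form: a mixture of the equilibrium error and the error of a run from the residual start -/

/-- **EXACT FORM**: for every start `μ₀` and every `b` there is a probability law `ν` (GEN-34's residual start
`μ₀R^b`) with `E_{μ₀}[(A_{N,b} − π f)²] = (1 − r^b)·MSE_π(N) + r^b·E_ν[(A_N − π f)²]`. [ours] -/
theorem imh_chain_windowMSE_anyStart_exists [Fact (Measurable w)] (hw0 : ∀ y, 0 < w y) {x₀ : Ω}
    (hmax : ∀ y, w y ≤ w x₀) [IsProbabilityMeasure (q.withDensity fun y => ENNReal.ofReal (w y))]
    (μ₀ : Measure Ω) [IsProbabilityMeasure μ₀] {f : Ω → ℝ} (hf : Measurable f) {a c : ℝ}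
    (ha : ∀ x, a ≤ f x) (hc : ∀ x, f x ≤ c) (b : ℕ) {N : ℕ} (hN : N ≠ 0) :
    ∃ ν : Measure Ω, IsProbabilityMeasure ν ∧
      ∫ x, ((∑ i ∈ range N, f (x (b + i))) / N - ∫ z, f z ∂(q.withDensity fun y => ENNReal.ofReal (w y))) ^ 2
          ∂(Kernel.trajMeasure (X := fun _ : ℕ => Ω) μ₀
            (fun n : ℕ => (indepMH q w).comap (fun h : (i : ↥(Finset.Iic n)) → Ω => h ⟨n, Finset.mem_Iic.2 le_rfl⟩)
              (measurable_pi_apply _))) =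
        (1 - (1 - (w x₀)⁻¹) ^ b) *
            ∫ x, ((∑ i ∈ range N, f (x i)) / N - ∫ z, f z ∂(q.withDensity fun y => ENNReal.ofReal (w y))) ^ 2
              ∂(Kernel.trajMeasure (X := fun _ : ℕ => Ω) (q.withDensity fun y => ENNReal.ofReal (w y))
                (fun n : ℕ => (indepMH q w).comap (fun h : (i : ↥(Finset.Iic n)) → Ω => h ⟨n, Finset.mem_Iic.2 le_rfl⟩)
                  (measurable_pi_apply _))) +
          (1 - (w x₀)⁻¹) ^ b *
            ∫ x, ((∑ i ∈ range N, f (x i)) / N - ∫ z, f z ∂(q.withDensity fun y => ENNReal.ofReal (w y))) ^ 2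
              ∂(Kernel.trajMeasure (X := fun _ : ℕ => Ω) ν
                (fun n : ℕ => (indepMH q w).comap (fun h : (i : ↥(Finset.Iic n)) → Ω => h ⟨n, Finset.mem_Iic.2 le_rfl⟩)
                  (measurable_pi_apply _))) := by
  obtain ⟨ν, hν, h⟩ := imh_chain_shift_anyStart_exists (q := q) hw0 hmax μ₀ b
  refine ⟨ν, hν, ?_⟩
  set m := ∫ z, f z ∂(q.withDensity fun y => ENNReal.ofReal (w y)) with hm
  have hW : 1 ≤ w x₀ := one_le_of_mode (q := q) hmax
  have hr0 : 0 ≤ 1 - (w x₀)⁻¹ := sub_nonneg.2 (inv_le_one_of_one_le₀ hW)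
  have hr1 : 1 - (w x₀)⁻¹ ≤ 1 := sub_le_self _ (inv_nonneg.mpr (hw0 x₀).le)
  have hc0 : 0 ≤ 1 - (1 - (w x₀)⁻¹) ^ b := sub_nonneg.2 (pow_le_one₀ hr0 hr1)
  set F : (ℕ → Ω) → ℝ := fun x => ((∑ i ∈ range N, f (x i)) / N - m) ^ 2 with hFdef
  have hF : Measurable F := measurable_sq_timeAverage_sub hf m N
  -- a uniform bound on the statistic: `|A_N − m| ≤ max|a||c| + |m|`
  have hC : ∀ x : ℕ → Ω, |F x| ≤ (max |a| |c| + |m|) ^ 2 := by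
    intro x
    have h1 : |(∑ i ∈ range N, f (x i)) / N - m| ≤ max |a| |c| + |m| :=
      (abs_sub _ _).trans (add_le_add (abs_timeAverage_le (fun y => abs_le_max_abs_abs (ha y) (hc y)) hN x) le_rfl)
    have h2 : |(∑ i ∈ range N, f (x i)) / N - m| ^ 2 ≤ (max |a| |c| + |m|) ^ 2 :=
      pow_le_pow_left₀ (abs_nonneg _) h1 2
    rw [sq_abs] at h2
    have h3 : |((∑ i ∈ range N, f (x i)) / N - m) ^ 2| = ((∑ i ∈ range N, f (x i)) / N - m) ^ 2 :=
      abs_of_nonneg (sq_nonneg _)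
    simpa only [hFdef, h3] using h2
  have hΘ : Measurable (fun (x : ℕ → Ω) (n : ℕ) => x (b + n)) :=
    measurable_pi_lambda _ fun n => measurable_pi_apply _
  have key := integral_map (μ := Kernel.trajMeasure (X := fun _ : ℕ => Ω) μ₀
      (fun n : ℕ => (indepMH q w).comap (fun h : (i : ↥(Finset.Iic n)) → Ω => h ⟨n, Finset.mem_Iic.2 le_rfl⟩)
        (measurable_pi_apply _))) hΘ.aemeasurable (f := F) hF.aestronglyMeasurable
  rw [h, integral_add_measure ((integrable_of_bounded _ hF hC).smul_measure ENNReal.ofReal_ne_top)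
      ((integrable_of_bounded _ hF hC).smul_measure ENNReal.ofReal_ne_top),
    integral_smul_measure, integral_smul_measure, ENNReal.toReal_ofReal hc0,
    ENNReal.toReal_ofReal (pow_nonneg hr0 b), smul_eq_mul, smul_eq_mul] at key
  exact key.symm

/-! ## §4 The explicit any-start error bar -/

/-- **`E_{μ₀}[(A_{N,b} − π f)²] ≤ (2w(x₀) − 1)·Var_π f/N + r^b·D²`** from every start (`N ≥ 1`). [ours] -/
theorem imh_chain_windowMSE_anyStart_le_explicit [Fact (Measurable w)] (hw0 : ∀ y, 0 < w y) {x₀ : Ω}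
    (hmax : ∀ y, w y ≤ w x₀) [IsProbabilityMeasure (q.withDensity fun y => ENNReal.ofReal (w y))]
    (μ₀ : Measure Ω) [IsProbabilityMeasure μ₀] {f : Ω → ℝ} (hf : Measurable f) {a c : ℝ}
    (ha : ∀ x, a ≤ f x) (hc : ∀ x, f x ≤ c) (b : ℕ) {N : ℕ} (hN : N ≠ 0) :
    ∫ x, ((∑ i ∈ range N, f (x (b + i))) / N - ∫ z, f z ∂(q.withDensity fun y => ENNReal.ofReal (w y))) ^ 2
        ∂(Kernel.trajMeasure (X := fun _ : ℕ => Ω) μ₀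
          (fun n : ℕ => (indepMH q w).comap (fun h : (i : ↥(Finset.Iic n)) → Ω => h ⟨n, Finset.mem_Iic.2 le_rfl⟩)
            (measurable_pi_apply _))) ≤
      (2 * w x₀ - 1) *
          (∫ x, (f x - ∫ z, f z ∂(q.withDensity fun y => ENNReal.ofReal (w y))) ^ 2
            ∂(q.withDensity fun y => ENNReal.ofReal (w y))) / N +
        (1 - (w x₀)⁻¹) ^ b *
          (max (∫ z, f z ∂(q.withDensity fun y => ENNReal.ofReal (w y)) - a)
            (c - ∫ z, f z ∂(q.withDensity fun y => ENNReal.ofReal (w y)))) ^ 2 := by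
  have hC : ∀ x, |f x| ≤ max |a| |c| := fun x => abs_le_max_abs_abs (ha x) (hc x)
  have h1 := imh_chain_windowMSE_anyStart_le (q := q) hw0 hmax μ₀ hf ha hc b hN
  have h2 := imh_chain_mse_stationary_le (q := q) hw0 hmax hf hC hN (x₀ := x₀)
  have h0 := imh_chain_windowMSE_anyStart_ge (q := q) hw0 hmax
    (q.withDensity fun y => ENNReal.ofReal (w y)) hf ha hc 0 hN
  simp only [pow_zero, sub_self, zero_mul, zero_add] at h0
  have hW : 1 ≤ w x₀ := one_le_of_mode (q := q) hmax
  have hr0 : 0 ≤ (1 - (w x₀)⁻¹) ^ b := pow_nonneg (sub_nonneg.2 (inv_le_one_of_one_le₀ hW)) b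
  nlinarith

/-- **With the burn-in rule**: `log(1/ε) ≤ b/w(x₀)` ⇒ `E_{μ₀}[(A_{N,b} − π f)²] ≤ (2w(x₀) − 1)·Var_π f/N + ε·D²`
from every start. [ours] -/
theorem imh_chain_windowMSE_anyStart_le_explicit_of_log_le [Fact (Measurable w)] (hw0 : ∀ y, 0 < w y) {x₀ : Ω}
    (hmax : ∀ y, w y ≤ w x₀) [IsProbabilityMeasure (q.withDensity fun y => ENNReal.ofReal (w y))]
    (μ₀ : Measure Ω) [IsProbabilityMeasure μ₀] {f : Ω → ℝ} (hf : Measurable f) {a c : ℝ}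
    (ha : ∀ x, a ≤ f x) (hc : ∀ x, f x ≤ c) {b : ℕ} {N : ℕ} (hN : N ≠ 0) {ε : ℝ} (hε : 0 < ε)
    (hb : Real.log (1 / ε) ≤ b * (w x₀)⁻¹) :
    ∫ x, ((∑ i ∈ range N, f (x (b + i))) / N - ∫ z, f z ∂(q.withDensity fun y => ENNReal.ofReal (w y))) ^ 2
        ∂(Kernel.trajMeasure (X := fun _ : ℕ => Ω) μ₀
          (fun n : ℕ => (indepMH q w).comap (fun h : (i : ↥(Finset.Iic n)) → Ω => h ⟨n, Finset.mem_Iic.2 le_rfl⟩)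
            (measurable_pi_apply _))) ≤
      (2 * w x₀ - 1) *
          (∫ x, (f x - ∫ z, f z ∂(q.withDensity fun y => ENNReal.ofReal (w y))) ^ 2
            ∂(q.withDensity fun y => ENNReal.ofReal (w y))) / N +
        ε * (max (∫ z, f z ∂(q.withDensity fun y => ENNReal.ofReal (w y)) - a)
            (c - ∫ z, f z ∂(q.withDensity fun y => ENNReal.ofReal (w y)))) ^ 2 := by
  have h1 := imh_chain_windowMSE_anyStart_le_explicit (q := q) hw0 hmax μ₀ hf ha hc b hN
  have h2 := mul_le_mul_of_nonneg_right (pow_mode_le_of_log_le (q := q) hmax hε hb)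
    (sq_nonneg (max (∫ z, f z ∂(q.withDensity fun y => ENNReal.ofReal (w y)) - a)
      (c - ∫ z, f z ∂(q.withDensity fun y => ENNReal.ofReal (w y)))))
  linarith

/-! ## §5 The equilibrium Chebyshev bar holds from every start at confidence cost `r^b` -/

/-- **`P_{μ₀}(|A_{N,b} − π f| ≥ s) ≤ (1 − r^b)·MSE_π(N)/s² + r^b`** from every start (`s > 0`). [ours] -/
theorem imh_chain_windowDeviation_anyStart_le [Fact (Measurable w)] (hw0 : ∀ y, 0 < w y) {x₀ : Ω}
    (hmax : ∀ y, w y ≤ w x₀) [IsProbabilityMeasure (q.withDensity fun y => ENNReal.ofReal (w y))]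
    (μ₀ : Measure Ω) [IsProbabilityMeasure μ₀] {f : Ω → ℝ} (hf : Measurable f) {C : ℝ} (hC : ∀ x, |f x| ≤ C)
    (b N : ℕ) {s : ℝ} (hs : 0 < s) :
    (Kernel.trajMeasure (X := fun _ : ℕ => Ω) μ₀
          (fun n : ℕ => (indepMH q w).comap (fun h : (i : ↥(Finset.Iic n)) → Ω => h ⟨n, Finset.mem_Iic.2 le_rfl⟩)
            (measurable_pi_apply _))).real
        {x | s ≤ |(∑ i ∈ range N, f (x (b + i))) / N - ∫ z, f z ∂(q.withDensity fun y => ENNReal.ofReal (w y))|} ≤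
      (1 - (1 - (w x₀)⁻¹) ^ b) *
          (∫ x, ((∑ i ∈ range N, f (x i)) / N - ∫ z, f z ∂(q.withDensity fun y => ENNReal.ofReal (w y))) ^ 2
            ∂(Kernel.trajMeasure (X := fun _ : ℕ => Ω) (q.withDensity fun y => ENNReal.ofReal (w y))
              (fun n : ℕ => (indepMH q w).comap (fun h : (i : ↥(Finset.Iic n)) → Ω => h ⟨n, Finset.mem_Iic.2 le_rfl⟩)
                (measurable_pi_apply _)))) / s ^ 2 +
        (1 - (w x₀)⁻¹) ^ b := by
  set m := ∫ z, f z ∂(q.withDensity fun y => ENNReal.ofReal (w y)) with hm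
  set Pπ := Kernel.trajMeasure (X := fun _ : ℕ => Ω) (q.withDensity fun y => ENNReal.ofReal (w y))
    (fun n : ℕ => (indepMH q w).comap (fun h : (i : ↥(Finset.Iic n)) → Ω => h ⟨n, Finset.mem_Iic.2 le_rfl⟩)
      (measurable_pi_apply _)) with hPπ
  have hAm : Measurable fun x : ℕ → Ω => |(∑ i ∈ range N, f (x i)) / N - m| :=
    ((((Finset.measurable_sum _ fun i _ => hf.comp (measurable_pi_apply i)).div_const _).sub
      measurable_const)).abs
  have hE : MeasurableSet {x : ℕ → Ω | s ≤ |(∑ i ∈ range N, f (x i)) / N - m|} :=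
    measurableSet_le measurable_const hAm
  have hpre : {x : ℕ → Ω | s ≤ |(∑ i ∈ range N, f (x (b + i))) / N - m|} =
      (fun (x : ℕ → Ω) (n : ℕ) => x (b + n)) ⁻¹' {x : ℕ → Ω | s ≤ |(∑ i ∈ range N, f (x i)) / N - m|} := by
    ext x; simp
  have h1 := imh_chain_shift_real_anyStart_le (q := q) hw0 hmax μ₀ hE b
  rw [← hpre] at h1
  have h2 : Pπ.real {x : ℕ → Ω | s ≤ |(∑ i ∈ range N, f (x i)) / N - m|} ≤
      (∫ x, ((∑ i ∈ range N, f (x i)) / N - m) ^ 2 ∂Pπ) / s ^ 2 :=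
    measureReal_abs_sub_ge_le (chain_memLp_timeAverage (indepMH q w) _ hf hC N) m hs
  have hW : 1 ≤ w x₀ := one_le_of_mode (q := q) hmax
  have hr0 : 0 ≤ 1 - (w x₀)⁻¹ := sub_nonneg.2 (inv_le_one_of_one_le₀ hW)
  have hr1 : 1 - (w x₀)⁻¹ ≤ 1 := sub_le_self _ (inv_nonneg.mpr (hw0 x₀).le)
  have hc0 : 0 ≤ 1 - (1 - (w x₀)⁻¹) ^ b := sub_nonneg.2 (pow_le_one₀ hr0 hr1)
  have h3 := mul_le_mul_of_nonneg_left h2 hc0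
  rw [← mul_div_assoc] at h3
  linarith

/-- **Explicitly**: `P_{μ₀}(|A_{N,b} − π f| ≥ s) ≤ (2w(x₀) − 1)·Var_π f/(N s²) + r^b` from every start
(`N ≥ 1`, `s > 0`) — the equilibrium Chebyshev radius, driven by `Var_π f`, at confidence cost `r^b`. [ours] -/
theorem imh_chain_windowDeviation_anyStart_le_explicit [Fact (Measurable w)] (hw0 : ∀ y, 0 < w y) {x₀ : Ω}
    (hmax : ∀ y, w y ≤ w x₀) [IsProbabilityMeasure (q.withDensity fun y => ENNReal.ofReal (w y))]
    (μ₀ : Measure Ω) [IsProbabilityMeasure μ₀] {f : Ω → ℝ} (hf : Measurable f) {C : ℝ} (hC : ∀ x, |f x| ≤ C)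
    (b : ℕ) {N : ℕ} (hN : N ≠ 0) {s : ℝ} (hs : 0 < s) :
    (Kernel.trajMeasure (X := fun _ : ℕ => Ω) μ₀
          (fun n : ℕ => (indepMH q w).comap (fun h : (i : ↥(Finset.Iic n)) → Ω => h ⟨n, Finset.mem_Iic.2 le_rfl⟩)
            (measurable_pi_apply _))).real
        {x | s ≤ |(∑ i ∈ range N, f (x (b + i))) / N - ∫ z, f z ∂(q.withDensity fun y => ENNReal.ofReal (w y))|} ≤
      (2 * w x₀ - 1) *
          (∫ x, (f x - ∫ z, f z ∂(q.withDensity fun y => ENNReal.ofReal (w y))) ^ 2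
            ∂(q.withDensity fun y => ENNReal.ofReal (w y))) / (N * s ^ 2) +
        (1 - (w x₀)⁻¹) ^ b := by
  have h1 := imh_chain_windowDeviation_anyStart_le (q := q) hw0 hmax μ₀ hf hC b N hs
  have h2 := imh_chain_mse_stationary_le (q := q) hw0 hmax hf hC hN (x₀ := x₀)
  have h0 := imh_chain_windowMSE_anyStart_ge (q := q) hw0 hmax (q.withDensity fun y => ENNReal.ofReal (w y)) hf
    (fun x => (abs_le.1 (hC x)).1) (fun x => (abs_le.1 (hC x)).2) 0 hN
  simp only [pow_zero, sub_self, zero_mul, zero_add] at h0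
  have hW : 1 ≤ w x₀ := one_le_of_mode (q := q) hmax
  have hc1 : 1 - (1 - (w x₀)⁻¹) ^ b ≤ 1 := sub_le_self _ (pow_nonneg (sub_nonneg.2 (inv_le_one_of_one_le₀ hW)) b)
  have hs2 : 0 < s ^ 2 := by positivity
  have h3 := div_le_div_of_nonneg_right ((mul_le_of_le_one_left h0 hc1).trans h2) hs2.le
  rw [div_div] at h3
  linarith

end Summit.Ventures.LatticeQCDFlow.Exactness
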